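import Summits.ResolutionOfSingularities.ResolutionOfSingularities.Theses.WildQuotients
import Summits.ResolutionOfSingularities.ResolutionOfSingularities.Theorems.PAlterationAssembly
import Literature.AlgebraicGeometry.Resolution.AlterationsResolution
import Literature.AlgebraicGeometry.Resolution.AlterationsPurelyInseparable
import Literature.AlgebraicGeometry.Resolution.AlterationsProofs

/-!
# `SummitReduction` — negative lemmas I: the shape of a counterexample and the load-bearing parts

Support (negative) lemmas for crux `stmt-ResolutionOfSingularities-16324`
(`Summit.ResolutionOfSingularities.ResolutionOfSingularities.Theses.WildQuotients.SummitReduction`: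
for every prime `p`, `WQ_p → PICover_p → ResolutionInChar p`, where `WQ_p` is the body of the crux
`WildQuotientResolution` at `p` — Galois-type quotients `X₁` of REGULAR integral `X'` by finite groups
have resolutions — and `PICover_p` the body of the crux `Picover` at `p` — finite radicial covers of
regular varieties have resolutions), filed by the standing disprover (cdisprove gen 1; work file
`Cruxes/SummitReduction/Disproof.lean`). This file declares NO definition: every variant statement is
written out inline, and NO declaration concludes a route decl positively.

* `not_resolutionOfSingularities_of_not_summitReduction`, `not_summitReduction_iff` — the summit
  implies the crux (an implication holds once its conclusion does), so `¬ SummitReduction` is EXACTLY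
  "a prime `p` at which both open cruxes `WQ_p`, `PICover_p` hold and resolution of singularities in
  characteristic `p` fails"; `exists_integral_not_hasResolution_of_not_summitReduction` — the failure
  is witnessed by an INTEGRAL separated finite-type variety (in-tree reduced → integral descent
  `DescentReducedToIntegral_holds`), of dimension `≥ 4` modulo the named fact `CossartPiltant2019`
  (`exists_dim_gt_three_of_not_summitReduction`; barrier `DimensionFourFrontier`).
* `not_summitReduction_iff_galoisSide` — using pAlteration's PROVED per-prime frame
  (`Theorems.hasResolution_of_thesis` + `DescentReducedToIntegral_holds`) and "a resolution is a purely
  inseparable regular alteration" (`IsResolution.isPurelyInseparableAlteration`): `¬ SummitReduction`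
  is exactly "a prime where `WQ_p` and `PICover_p` hold and the Abramovich–Oort statement `PIAlt_p`
  (body of the target `Pialt`) FAILS". Hence `not_pialt_of_not_summitReduction` and
  `not_galoisReduction_of_not_summitReduction`.
* `not_galoisQuotientAlteration_of_not_summitReduction` — composing the WQ-resolution of `X₁ = X'/G`
  with the generically finite radicial `φ : X₁ → X` of de Jong's datum
  (`IsPurelyInseparableAlteration.comp`, in tree) shows that a disproof of the crux is a
  COUNTEREXAMPLE TO de Jong 1997 Cor. 5.15 AS TYPED by the route (support `GaloisQuotientAlteration`),
  a published theorem (any field: `S = Spec k` is excellent of dimension `0 ≤ 2`; quotient `X'/G` by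
  SGA 1 V.1 since de Jong's `X'` is quasi-projective, proof of Thm 5.13 p. 620).
* `wq_imp_summit_iff`, `picover_imp_summit_iff` — LOAD-BEARING ANTECEDENTS (globalised): dropping
  `Picover` from the reduction asks `WildQuotientResolution` alone for `Pialt ∧ Picover` (the
  inseparable residue — the recorded death point of the alteration programme); dropping
  `WildQuotientResolution` asks `Picover` alone for `Pialt`. Both are open; neither is refutable without
  a counterexample to resolution.
* `summitReduction_trivial_without_isRegular_upstairs`, `summitReduction_trivial_without_surjective_upstairs`
  — INSIDE the antecedent `WQ_p`, the hypotheses `Scheme.IsRegular X'` and `Function.Surjective q.base`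
  are what give the crux content: delete either and the reduction is provable in a few lines WITHOUT
  de Jong and without Picover (`X' = X₁ = X`, `G = 1`, `q = 𝟙`; resp. `X' = Spec κ(x)` a closed point,
  `U = X ∖ {x}` with empty source over `U`) — those versions of WQ are the summit in costume.

## Sources
* A. J. de Jong, *Families of curves and alterations*, Ann. Inst. Fourier 47 (1997) 599–621
  (doi:10.5802/aif.1575): 5.3 (p. 613), (5.12.1), Thm. 5.13 (pp. 619–620, proof p. 620), Cor. 5.15
  (p. 620).
* M. Temkin, *Inseparable local uniformization*, J. Algebra 373 (2013): Conj. 1.3.1, §1 (i) ⊂ (iii).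
* V. Cossart, O. Piltant, J. Algebra 529 (2019), Thm. 1.1 (named fact `CossartPiltant2019`).
* SGA 1, Exp. V §1–2 (quotients by finite groups).
-/

noncomputable section

-- single-problem summit: the doubled namespace component `ResolutionOfSingularities` is forced
set_option linter.dupNamespace false

open CategoryTheory AlgebraicGeometry TopologicalSpace Topology
open Literature.AlgebraicGeometry.Resolution

namespace Summit.ResolutionOfSingularities.ResolutionOfSingularities.Theorems.SummitReduction.Negative

open Summit.ResolutionOfSingularities.ResolutionOfSingularities.Theses.WildQuotients
  (SummitReduction WildQuotientResolution Picover Pialt GaloisReduction GaloisQuotientAlteration)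

/-! ## The summit implies the crux: the exact shape of a counterexample -/

/-- **A disproof of the crux is a disproof of resolution of singularities in positive
characteristic**: if `ResolutionInChar p` holds for every prime the implication holds regardless of
its antecedents. [folklore] -/
theorem not_resolutionOfSingularities_of_not_summitReduction (h : ¬ SummitReduction) :
    ¬ _root_.ResolutionOfSingularities :=
  fun hR => h fun p hp _ _ => (_root_.ResolutionOfSingularities_iff.mp hR) p hp

/-- **The exact shape of a counterexample to the crux**: a prime `p` at which BOTH open cruxes of the
route hold — `WQ_p` (body of `WildQuotientResolution`) and `PICover_p` (body of `Picover`), verbatim —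
and resolution of singularities in characteristic `p` FAILS. [folklore] -/
theorem not_summitReduction_iff :
    ¬ SummitReduction ↔ ∃ p : ℕ, p.Prime ∧
      (∀ (k : Type) [Field k] [CharP k p] (X' X₁ : Scheme.{0}) (f : X₁ ⟶ Spec (.of k)) (q : X' ⟶ X₁)
        (G : Type) [Group G] [Finite G] (ρ : G →* Aut X'), IsSeparated f → LocallyOfFiniteType f →
        QuasiCompact f → IsIntegral X₁ → IsIntegral X' → Scheme.IsRegular X' → IsFinite q →
        Function.Surjective q.base → (∃ U : X₁.Opens, Dense (U : Set X₁) ∧ Etale (q ∣_ U)) →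
        (∀ g : G, (ρ g).hom ≫ q = q) →
        (∀ x y : X', q.base x = q.base y → ∃ g : G, (ρ g).hom.base x = y) →
        Scheme.HasResolution X₁) ∧
      (∀ (k : Type) [Field k] [CharP k p] (Y X : Scheme.{0}) (f : Y ⟶ Spec (.of k)) (g : X ⟶ Y),
        IsSeparated f → LocallyOfFiniteType f → QuasiCompact f → IsIntegral Y → Scheme.IsRegular Y →
        IsIntegral X → IsFinite g → UniversallyInjective g → Function.Surjective g.base →
        Scheme.HasResolution X) ∧
      ¬ ResolutionInChar.{0} p := by
  constructor
  · intro h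
    by_contra hcon
    exact h fun p hp hW hP => by_contra fun hR => hcon ⟨p, hp, hW, hP, hR⟩
  · rintro ⟨p, hp, hW, hP, hR⟩ h
    exact hR (h p hp hW hP)

/-- **Any witness against the crux contains an integral separated finite-type variety over a field of
characteristic `p` WITHOUT a weak resolution** (reduced → integral by the in-tree descent
`DescentReducedToIntegral_holds`). [folklore] -/
theorem exists_integral_not_hasResolution_of_not_summitReduction (h : ¬ SummitReduction) :
    ∃ p : ℕ, p.Prime ∧ ∃ (k : Type) (_ : Field k) (_ : CharP k p) (X : Scheme.{0})
      (f : X ⟶ Spec (.of k)), IsSeparated f ∧ LocallyOfFiniteType f ∧ QuasiCompact f ∧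
        IsIntegral X ∧ ¬ Scheme.HasResolution X := by
  obtain ⟨p, hp, -, -, hR⟩ := not_summitReduction_iff.mp h
  refine ⟨p, hp, ?_⟩
  by_contra hcon
  apply hR
  intro k _ _ X f hs hl hq hr
  refine Theses.PAlteration.DescentReducedToIntegral_holds k ?_ X f hs hl hq hr
  intro Y g hs' hl' hq' hi'
  by_contra hY
  exact hcon ⟨k, inferInstance, inferInstance, Y, g, hs', hl', hq', hi', hY⟩

/-- **Dimension `≥ 4`** (modulo the named fact `CossartPiltant2019`): the integral witness against the
crux is not of dimension `≤ 3` — barrier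
`Literature.Barriers.ResolutionOfSingularities.DimensionFourFrontier` applies verbatim.
[cite: CossartPiltant2019, Thm. 1.1] -/
theorem exists_dim_gt_three_of_not_summitReduction (hCP : CossartPiltant2019.{0})
    (h : ¬ SummitReduction) :
    ∃ p : ℕ, p.Prime ∧ ∃ (k : Type) (_ : Field k) (_ : CharP k p) (X : Scheme.{0})
      (f : X ⟶ Spec (.of k)), IsSeparated f ∧ LocallyOfFiniteType f ∧ QuasiCompact f ∧
        IsIntegral X ∧ ¬ topologicalKrullDim X ≤ 3 ∧ ¬ Scheme.HasResolution X := by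
  obtain ⟨p, hp, k, _, _, X, f, hs, hl, hq, hi, hX⟩ :=
    exists_integral_not_hasResolution_of_not_summitReduction h
  refine ⟨p, hp, k, inferInstance, inferInstance, X, f, hs, hl, hq, hi, fun hdim => hX ?_, hX⟩
  haveI := hs; haveI := hl; haveI := hq
  exact hasResolution_of_dim_le_three hCP k X f hdim

/-! ## The exact open content: the Galois side, prime by prime -/

/-- **`¬ SummitReduction` is exactly "a prime where `WQ_p` and `PICover_p` hold and Abramovich–Oort
`PIAlt_p` (the body of the route's target `Pialt`) FAILS"**: `→` because pAlteration's PROVED frame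
(`Theorems.hasResolution_of_thesis`, every field, + `DescentReducedToIntegral_holds`) turns
`PIAlt_p ∧ PICover_p` into `ResolutionInChar p`; `←` because a resolution of an integral `X` IS a
purely inseparable regular alteration (`IsResolution.isPurelyInseparableAlteration`). So the crux is
"WQ ∧ Picover ⇒ Abramovich–Oort, prime by prime" (the route proves the stronger `WQ_p → PIAlt_p` from
de Jong 1997). [cite: Temkin2013, Conj. 1.3.1 and §1 (i), (iii)] -/
theorem not_summitReduction_iff_galoisSide :
    ¬ SummitReduction ↔ ∃ p : ℕ, p.Prime ∧
      (∀ (k : Type) [Field k] [CharP k p] (X' X₁ : Scheme.{0}) (f : X₁ ⟶ Spec (.of k)) (q : X' ⟶ X₁)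
        (G : Type) [Group G] [Finite G] (ρ : G →* Aut X'), IsSeparated f → LocallyOfFiniteType f →
        QuasiCompact f → IsIntegral X₁ → IsIntegral X' → Scheme.IsRegular X' → IsFinite q →
        Function.Surjective q.base → (∃ U : X₁.Opens, Dense (U : Set X₁) ∧ Etale (q ∣_ U)) →
        (∀ g : G, (ρ g).hom ≫ q = q) →
        (∀ x y : X', q.base x = q.base y → ∃ g : G, (ρ g).hom.base x = y) →
        Scheme.HasResolution X₁) ∧
      (∀ (k : Type) [Field k] [CharP k p] (Y X : Scheme.{0}) (f : Y ⟶ Spec (.of k)) (g : X ⟶ Y),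
        IsSeparated f → LocallyOfFiniteType f → QuasiCompact f → IsIntegral Y → Scheme.IsRegular Y →
        IsIntegral X → IsFinite g → UniversallyInjective g → Function.Surjective g.base →
        Scheme.HasResolution X) ∧
      ¬ (∀ (k : Type) [Field k] [CharP k p] (X : Scheme.{0}) (f : X ⟶ Spec (.of k)), IsSeparated f →
        LocallyOfFiniteType f → QuasiCompact f → IsIntegral X → ∃ (X' : Scheme.{0}) (g : X' ⟶ X),
        IsProper g ∧ IsIntegral X' ∧ Scheme.IsRegular X' ∧ Function.Surjective g.base ∧
        ∃ U : X.Opens, Dense (U : Set X) ∧ IsFinite (g ∣_ U) ∧ UniversallyInjective (g ∣_ U)) := by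
  rw [not_summitReduction_iff]
  refine exists_congr fun p => and_congr_right fun hp => and_congr_right fun _ =>
    and_congr_right fun hPC => not_congr ⟨fun hR => ?_, fun hPI => ?_⟩
  · -- a resolution of an integral `X` is a purely inseparable regular alteration
    intro k _ _ X f hs hl hq hi
    obtain ⟨Y, φ, hφ, hreg⟩ :=
      (hR k X f hs hl hq inferInstance).exists_isPurelyInseparableAlteration_and_isRegular
    exact ⟨Y, φ, hφ.isProper, hφ.isIntegral, hreg, hφ.surjective.1, hφ.exists_dense⟩
  · -- pAlteration's proved frame, prime by prime
    haveI : Fact p.Prime := ⟨hp⟩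
    intro k _ _ X f hs hl hq hr
    exact Theses.PAlteration.DescentReducedToIntegral_holds k (fun Y g h1 h2 h3 h4 => by
      haveI := h1; haveI := h2; haveI := h3; haveI := h4
      exact Theorems.hasResolution_of_thesis p hPI hPC g) X f hs hl hq hr

/-- **A disproof of the crux disproves the route's TARGET `Pialt`** (Abramovich–Oort 2000 Q. 2.13 /
Temkin 2013 Conj. 1.3.1, char-`p` slice — open, believed true). [cite: Temkin2013, Conj. 1.3.1] -/
theorem not_pialt_of_not_summitReduction (h : ¬ SummitReduction) : ¬ Pialt := by
  obtain ⟨p, hp, -, -, hPI⟩ := not_summitReduction_iff_galoisSide.mp h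
  exact fun hP => hPI (hP p hp)

/-- … and, granted the crux `WildQuotientResolution`, disproves the support `GaloisReduction`
(`WildQuotientResolution → Pialt`). [folklore] -/
theorem not_galoisReduction_of_not_summitReduction (h : ¬ SummitReduction)
    (hW : WildQuotientResolution) : ¬ GaloisReduction :=
  fun hGR => not_pialt_of_not_summitReduction h (hGR hW)

/-- **A disproof of the crux is a counterexample to de Jong's Galois alteration theorem AS TYPED by
the route** (support `GaloisQuotientAlteration`, stmt-16323 = de Jong 1997 Cor. 5.15 with 5.3,
(5.12.1), Thm. 5.13, case `S = Spec k` — any field — plus the scheme quotient `X'/G` of SGA 1 V.1).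
Proof: at the witness prime, de Jong's datum for the integral `X` gives `X'` regular with `G` acting,
`q : X' → X₁` satisfying the binders of `WQ_p` verbatim (structure map `φ ≫ f`), and `φ : X₁ → X` proper
surjective, finite and radicial over a dense open; `WQ_p` resolves `X₁` by some `π : Y → X₁`, a purely
inseparable alteration (`IsResolution.isPurelyInseparableAlteration`), and `π ≫ φ` is again one
(`IsPurelyInseparableAlteration.comp`) with regular source — i.e. `PIAlt_p` holds at `X`,
contradicting `not_summitReduction_iff_galoisSide`.
[cite: DeJong1997, Cor. 5.15 (with 5.3, (5.12.1), Thm. 5.13), pp. 613–620] -/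
theorem not_galoisQuotientAlteration_of_not_summitReduction (h : ¬ SummitReduction) :
    ¬ GaloisQuotientAlteration := by
  obtain ⟨p, hp, hW, -, hPI⟩ := not_summitReduction_iff_galoisSide.mp h
  intro hGQA
  apply hPI
  intro k _ _ X f hs hl hq hi
  obtain ⟨X', X₁, q, φ, G, _, _, ρ, hs1, hl1, hq1, hi1, hi', hreg, hfin, hsurj, hU, hinv, horb, hprop,
    hφsurj, V, hV, hVfin, hVui⟩ := hGQA p hp k X f hs hl hq hi
  obtain ⟨Y, π, hπ⟩ := hW k X' X₁ (φ ≫ f) q G ρ hs1 hl1 hq1 hi1 hi' hreg hfin hsurj hU hinv horb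
  haveI := hi1
  haveI := hprop
  haveI : Surjective φ := ⟨hφsurj⟩
  have h1 : IsPurelyInseparableAlteration π := hπ.isPurelyInseparableAlteration
  have h2 : IsPurelyInseparableAlteration φ := ⟨hi1, hprop, inferInstance, V, hV.nonempty, hVfin, hVui⟩
  have h12 : IsPurelyInseparableAlteration (π ≫ φ) := h1.comp h2
  exact ⟨Y, π ≫ φ, h12.isProper, h12.isIntegral, hπ.isRegular, h12.surjective.1, h12.exists_dense⟩

/-! ## Load-bearing antecedents (globalised) -/

/-- **Dropping `Picover` from the reduction = asking `WildQuotientResolution` ALONE for Abramovich–Oort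
AND the inseparable residue `Picover`**: `(WQ → summit) ↔ (WQ → Pialt ∧ Picover)` (`→`: a resolution
is a p.i. regular alteration, and resolves the radicial cover directly; `←`: pAlteration's proved
frame). Modulo de Jong (`WQ → Pialt`, support `GaloisReduction`) the right side is `WQ → Picover` —
de Jong 1997 Cor. 5.15's "up to … a purely inseparable extension of `R(X)`", the recorded death point
of the alteration programme. Open; irrefutable without a counterexample to resolution. [folklore] -/
theorem wq_imp_summit_iff :
    (WildQuotientResolution → _root_.ResolutionOfSingularities) ↔
      (WildQuotientResolution → Pialt ∧ Picover) := by
  constructor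
  · intro h hW
    have hR := _root_.ResolutionOfSingularities_iff.mp (h hW)
    refine ⟨fun p hp k _ _ X f hs hl hq hi => ?_, fun p hp k _ _ Y X f g hs hl hq _ _ hi hfin _ _ => ?_⟩
    · obtain ⟨Z, φ, hφ, hreg⟩ :=
        (hR p hp k X f hs hl hq inferInstance).exists_isPurelyInseparableAlteration_and_isRegular
      exact ⟨Z, φ, hφ.isProper, hφ.isIntegral, hreg, hφ.surjective.1, hφ.exists_dense⟩
    · haveI := hs; haveI := hl; haveI := hq; haveI := hfin
      exact hR p hp k X (g ≫ f) inferInstance inferInstance inferInstance inferInstance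
  · intro h hW
    obtain ⟨hPI, hPC⟩ := h hW
    refine _root_.ResolutionOfSingularities_iff.mpr fun p hp => ?_
    haveI : Fact p.Prime := ⟨hp⟩
    intro k _ _ X f hs hl hq hr
    exact Theses.PAlteration.DescentReducedToIntegral_holds k (fun Y g h1 h2 h3 h4 => by
      haveI := h1; haveI := h2; haveI := h3; haveI := h4
      exact Theorems.hasResolution_of_thesis p (hPI p hp) (hPC p hp) g) X f hs hl hq hr

/-- **Dropping `WildQuotientResolution` from the reduction = asking `Picover` ALONE for
Abramovich–Oort**: `(Picover → summit) ↔ (Picover → Pialt)`. Open; irrefutable without a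
counterexample to resolution. [folklore] -/
theorem picover_imp_summit_iff :
    (Picover → _root_.ResolutionOfSingularities) ↔ (Picover → Pialt) := by
  constructor
  · intro h hPC p hp k _ _ X f hs hl hq hi
    have hR := _root_.ResolutionOfSingularities_iff.mp (h hPC)
    obtain ⟨Z, φ, hφ, hreg⟩ :=
      (hR p hp k X f hs hl hq inferInstance).exists_isPurelyInseparableAlteration_and_isRegular
    exact ⟨Z, φ, hφ.isProper, hφ.isIntegral, hreg, hφ.surjective.1, hφ.exists_dense⟩
  · intro h hPC
    have hPI := h hPC
    refine _root_.ResolutionOfSingularities_iff.mpr fun p hp => ?_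
    haveI : Fact p.Prime := ⟨hp⟩
    intro k _ _ X f hs hl hq hr
    exact Theses.PAlteration.DescentReducedToIntegral_holds k (fun Y g h1 h2 h3 h4 => by
      haveI := h1; haveI := h2; haveI := h3; haveI := h4
      exact Theorems.hasResolution_of_thesis p (hPI p hp) (hPC p hp) g) X f hs hl hq hr

/-! ## Load-bearing hypotheses inside the antecedent `WQ_p` -/

/-- **`Scheme.IsRegular X'` inside the antecedent is what gives the crux content**: with it DELETED
from `WQ_p` the reduction is TRIVIAL (no de Jong, no Picover) — present the integral `X` as its own
quotient by the trivial group (`X' = X₁ = X`, `q = 𝟙`: finite, surjective, étale, invariant, fibres =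
orbits) and descend reduced → integral. So that version of WQ is the summit in costume. [folklore] -/
theorem summitReduction_trivial_without_isRegular_upstairs :
    ∀ p : ℕ, p.Prime →
      (∀ (k : Type) [Field k] [CharP k p] (X' X₁ : Scheme.{0}) (f : X₁ ⟶ Spec (.of k)) (q : X' ⟶ X₁)
        (G : Type) [Group G] [Finite G] (ρ : G →* Aut X'), IsSeparated f → LocallyOfFiniteType f →
        QuasiCompact f → IsIntegral X₁ → IsIntegral X' → IsFinite q →
        Function.Surjective q.base → (∃ U : X₁.Opens, Dense (U : Set X₁) ∧ Etale (q ∣_ U)) →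
        (∀ g : G, (ρ g).hom ≫ q = q) →
        (∀ x y : X', q.base x = q.base y → ∃ g : G, (ρ g).hom.base x = y) →
        Scheme.HasResolution X₁) →
      ResolutionInChar.{0} p := by
  intro p _ hW k _ _ X f hs hl hq hr
  refine Theses.PAlteration.DescentReducedToIntegral_holds k ?_ X f hs hl hq hr
  intro Y g hs' hl' hq' hi'
  have h1 : ((1 : PUnit →* Aut Y) PUnit.unit).hom = 𝟙 Y := rfl
  refine hW k Y Y g (𝟙 Y) PUnit (1 : PUnit →* Aut Y) hs' hl' hq' hi' hi' inferInstance
    (fun y => ⟨y, rfl⟩) ⟨⊤, by simp, inferInstance⟩ (fun _ => by rw [h1, Category.comp_id]) ?_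
  intro x y hxy
  exact ⟨1, by rw [h1]; exact hxy⟩

/-- **`Function.Surjective q.base` inside the antecedent is what excludes the closed-point junk**:
with it DELETED from `WQ_p` the reduction is again TRIVIAL — for an integral `X` with a closed point
`x` and `X ≠ {x}` take `X' = Spec κ(x)` (integral, zero-dimensional hence regular), `q` the closed
immersion (finite), `G = 1`, `U = X ∖ {x}` (dense; `q` has EMPTY source over `U`, so it is étale
there); fibres are orbits because `X'` is one point. If `X = {x}`, `X` is zero-dimensional, hence
regular. So that version of WQ is the summit in costume, too. [folklore] -/
theorem summitReduction_trivial_without_surjective_upstairs :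
    ∀ p : ℕ, p.Prime →
      (∀ (k : Type) [Field k] [CharP k p] (X' X₁ : Scheme.{0}) (f : X₁ ⟶ Spec (.of k)) (q : X' ⟶ X₁)
        (G : Type) [Group G] [Finite G] (ρ : G →* Aut X'), IsSeparated f → LocallyOfFiniteType f →
        QuasiCompact f → IsIntegral X₁ → IsIntegral X' → Scheme.IsRegular X' → IsFinite q →
        (∃ U : X₁.Opens, Dense (U : Set X₁) ∧ Etale (q ∣_ U)) →
        (∀ g : G, (ρ g).hom ≫ q = q) →
        (∀ x y : X', q.base x = q.base y → ∃ g : G, (ρ g).hom.base x = y) →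
        Scheme.HasResolution X₁) →
      ResolutionInChar.{0} p := by
  intro p _ hW k _ _ X f hs hl hq hr
  refine Theses.PAlteration.DescentReducedToIntegral_holds k ?_ X f hs hl hq hr
  intro Y g hs' hl' hq' hi'
  haveI := hq'
  haveI : CompactSpace Y := QuasiCompact.compactSpace_of_compactSpace g
  obtain ⟨x, -, hx⟩ :=
    (isClosed_univ : IsClosed (Set.univ : Set Y)).exists_closed_singleton Set.univ_nonempty
  by_cases hY : ∃ y : Y, y ≠ x
  · haveI : IsClosedImmersion (Y.fromSpecResidueField x) :=
      isClosed_singleton_iff_isClosedImmersion.mp hx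
    let U : Y.Opens := ⟨{x}ᶜ, hx.isOpen_compl⟩
    have hU : Dense (U : Set Y) := by
      obtain ⟨y, hy⟩ := hY
      exact U.isOpen.dense ⟨y, Set.mem_compl_singleton_iff.mpr hy⟩
    haveI : IsEmpty (↑((Y.fromSpecResidueField x) ⁻¹ᵁ U) : Scheme.{0}) := ⟨fun s => by
      have h1 : (Y.fromSpecResidueField x).base s.1 ∈ (U : Set Y) := s.2
      have h2 : (Y.fromSpecResidueField x).base s.1 = x := Y.fromSpecResidueField_apply x s.1
      rw [h2] at h1
      exact h1 rfl⟩
    have h1 : ((1 : PUnit →* Aut (Spec (Y.residueField x))) PUnit.unit).hom = 𝟙 _ := rfl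
    refine hW k _ Y g (Y.fromSpecResidueField x) PUnit 1 hs' hl' hq' hi' inferInstance
      (Scheme.IsRegular.of_topologicalKrullDim_le_zero
        (topologicalKrullDim_zero_of_discreteTopology _))
      inferInstance ⟨U, hU, inferInstance⟩ (fun _ => by rw [h1, Category.id_comp]) ?_
    intro a b _
    exact ⟨1, Subsingleton.elim _ _⟩
  · -- `Y = {x}` is a zero-dimensional integral scheme, hence regular
    push Not at hY
    haveI : Subsingleton Y := ⟨fun a b => (hY a).trans (hY b).symm⟩
    exact (Scheme.IsRegular.of_topologicalKrullDim_le_zero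
      (topologicalKrullDim_zero_of_discreteTopology _)).hasResolution

end Summit.ResolutionOfSingularities.ResolutionOfSingularities.Theorems.SummitReduction.Negative

end
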